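import Summits.BirchSwinnertonDyer.BirchSwinnertonDyer.Theses.KatoDescentTamePotSupersingular
import Literature.NumberTheory.EllipticCurves.MazurTorsionOrderValuationProofs
import HarnessLib

/-!
# Route `KatoDescentTamePotSupersingular` (rung K8, sub-rung B4 (t′), cell `bsd-potss`): the row crux
# `TameUpperReducibleDefect` (U₀-red, item stmt-BirchSwinnertonDyer-19203; child of U₀ = item 19982)
# is, granted Mazur's torsion theorem, the ODD-PARITY rows plus the `9`-torsion-member rows at `p = 3`
# (a `--supports` file)

`TameUpperReducibleDefect` asks for the upper half `ord_p #Ш ≤ ord_p #Ш_an` on the rank-`0` (t′)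
rows with `E[p]` REDUCIBLE that are not covered by the member bound: a `ℤ/p²` inside `#E'(ℚ)_tors`
for some `E'` isogenous to `E`, or `ord_p #Ш_an(E)` odd. By Mazur's torsion theorem in its printed
order form (named fact `Mazur1977_addOrderOf_le`, Mazur 1977 Thm. (7') p. 35: a rational torsion
point has order `≤ 10` or `= 12`, whence `#E'(ℚ)_tors ≤ 24 < 25 ≤ p²` — tree theorem
`not_sq_dvd_torsionOrder_of_mazur`, file `MazurTorsionOrderValuationProofs`) the first disjunct is
VOID at `p ≥ 5`, and at `p = 3` it reads `9 ∣ #E'(ℚ)_tors`. The theorem below is the RESHAPED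
COMPOSITION of the row crux BY NAME: granted `Mazur1977_addOrderOf_le` for every curve, the crux
follows from (i) the upper half on the rank-`0` (t′) rows with `E[p]` reducible and `ord_p #Ш_an(E)`
odd (any odd `p`) and (ii) the upper half at `p = 3` on the rank-`0` (t′) rows (`e = 4`, Kodaira
III/III*) with `E[3]` reducible and a `ℚ`-isogenous curve with `9 ∣ #E'(ℚ)_tors`. Nothing about (i),
(ii) or Mazur's theorem is asserted; the item is NOT closed (conditional helper). Seat `bsd-potss-k8t-c4`.

Honest note for the tenure planner: in the BSD-true world (i) is EMPTY (`#Ш_an = #Ш` is a square by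
Cassels–Tate), so (i) can only be closed by the exact formula on those rows — i.e. by sharpening the
member bound's torsion slack `3·ord_p #tors` to `2·ord_p #tors` at the Kato member (crux M /
`ReducibleKatoMember`), after which Cassels' invariance of `#Ш_an/#Ш` transports it to every member.

References: [Mazur1977] Thm. (7') p. 35, Cor. III.(5.2) p. 156; [Kato2004Asterisque] Thm. 14.5 (3) (p. 236);
[GreenbergLNM1716] Prop. 4.13.
-/

set_option autoImplicit false
-- sibling precedent (`KatoDescentTamePotSupersingularAssembly.lean`): the directory name repeats the summit name
set_option linter.dupNamespace false

noncomputable section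

open scoped Classical

namespace Summit.BirchSwinnertonDyer.BirchSwinnertonDyer.Theorems

open WeierstrassCurve Literature.NumberTheory.EllipticCurves
  Literature.NumberTheory.EllipticCurves.Rank1Residual
  Literature.NumberTheory.EllipticCurves.Rank1Residual.Typed
  Summit.BirchSwinnertonDyer.Rank1Residual.Additive
  Summit.BirchSwinnertonDyer.BirchSwinnertonDyer.Theses.KatoDescentTamePotSupersingular

/-- An odd prime other than `3` is at least `5`. [folklore] -/
private theorem five_le_of_prime_of_ne_two_of_ne_three' {p : ℕ} (hp : p.Prime) (h2 : p ≠ 2)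
    (h3 : p ≠ 3) : 5 ≤ p := by
  rcases Nat.lt_or_ge p 5 with h | h
  · have h2le := hp.two_le
    interval_cases p
    · exact absurd rfl h2
    · exact absurd rfl h3
    · exact absurd hp (by decide)
  · exact h

/-- **RESHAPED COMPOSITION of the row crux `TameUpperReducibleDefect` BY NAME** (for the tenure
planner): granted Mazur's torsion theorem (order form) for every elliptic curve over `ℚ` (`hMz`,
named fact `Mazur1977_addOrderOf_le`), the crux follows from (i) the upper half on the rank-`0` (t′) rows with `E[p]`
reducible and `ord_p #Ш_an(E)` odd, and (ii) the upper half at `p = 3` on the rank-`0` (t′) rows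
with `E[3]` reducible and some `ℚ`-isogenous `E'` with `9 ∣ #E'(ℚ)_tors`. Case split on the crux's
"not covered" hypothesis; at `p ≥ 5` the torsion disjunct contradicts the tree theorem
`not_sq_dvd_torsionOrder_of_mazur`. Nothing about (i), (ii) or Mazur's theorem is asserted
(conditional: the item is NOT closed). [cite: Mazur1977, Thm. (7') p. 35 and Cor. III.(5.2) p. 156] -/
theorem tameUpperReducibleDefect_of_mazur_of_oddParity_of_nineTorsion
    (hMz : ∀ (V : WeierstrassCurve ℚ), Mazur1977_addOrderOf_le V)
    (hodd : ∀ (W : WeierstrassCurve ℚ) [W.IsElliptic] [W.IsGloballyMinimal] (p : ℕ) [Fact p.Prime],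
      W.analyticRank = 0 → p ≠ 2 → Addv W p → SubTprime W p → ¬ W.HasIrreducibleModPGaloisRep p →
      (∃ q : ℚ, shaAn W = (q : ℂ) ∧ ¬ Even (padicValRat p q)) → MissingUpperBoundAt W p)
    (hnine : ∀ (W : WeierstrassCurve ℚ) [W.IsElliptic] [W.IsGloballyMinimal] [Fact (Nat.Prime 3)],
      W.analyticRank = 0 → Addv W 3 → SubTprime W 3 → ¬ W.HasIrreducibleModPGaloisRep 3 →
      (∃ (W' : WeierstrassCurve ℚ) (_ : W'.IsElliptic), IsIsogenous W W' ∧ 9 ∣ W'.torsionOrder) →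
      MissingUpperBoundAt W 3) :
    Summit.BirchSwinnertonDyer.BirchSwinnertonDyer.Theses.KatoDescentTamePotSupersingular.TameUpperReducibleDefect := by
  intro W _ _ p _ hr hp2 hadd hT hred hdef
  by_cases hpar : ∀ q : ℚ, shaAn W = (q : ℂ) → Even (padicValRat p q)
  · -- the parity clause holds, so the torsion clause fails: some isogenous `W'` has `p² ∣ #W'(ℚ)_tors`
    have htor : ¬ ∀ (W' : WeierstrassCurve ℚ) [W'.IsElliptic],
        IsIsogenous W W' → ¬ p ^ 2 ∣ W'.torsionOrder := fun h ↦ hdef ⟨h, hpar⟩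
    push Not at htor
    obtain ⟨W', hW', hiso, hdvd⟩ := htor
    by_cases h3 : p = 3
    · subst h3
      exact hnine W hr hadd hT hred ⟨W', hW', hiso, by simpa using hdvd⟩
    · exact absurd hdvd
        (not_sq_dvd_torsionOrder_of_mazur W' (hMz W')
          (five_le_of_prime_of_ne_two_of_ne_three' Fact.out hp2 h3))
  · push Not at hpar
    obtain ⟨q, hq, hodd'⟩ := hpar
    exact hodd W p hr hp2 hadd hT hred ⟨q, hq, hodd'⟩

end Summit.BirchSwinnertonDyer.BirchSwinnertonDyer.Theorems

end
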